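import Summits.QuantumFields.YangMills.Theorems.ParabolicTrajectoryContinuumLimitOnTrajectoryJCGDefs
import Summits.QuantumFields.YangMills.Theorems.ParabolicTrajectoryContinuumLimitOnTrajectoryJCGLevelSetChart

/-!
# Route `ParabolicTrajectory`, crux `ContinuumLimitOnTrajectory` (stmt-QuantumFields-10522), line `jacobian-collapse-gronwall`: stub `stub_levelSetTransport` (file 2 of 2)

The registered stub `stub_levelSetTransport : LevelSetTransport` of the skeleton
`Cruxes/ContinuumLimitOnTrajectory/Lines/jacobian_collapse_gronwall.lean` (vocabulary `…JCGDefs`: `jac`,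
`scalingWindow`, `CollapseOn`, `LevelSetTransport`), pure real analysis over Mathlib:

* §1 part (b) in one variable: the ratio mean-value bound `|Δf| ≤ L |Δg|` from `g' ≠ 0`, `|f'| ≤ L |g'|`
  on an order-connected set (`abs_sub_le_mul_abs_sub_of_deriv`, Cauchy's mean value theorem);
* §2 part (a) with the window and the collapse hypotheses unbundled (`levelSet_continuation`): continuation
  by supremum over the scales reachable by a continuous monotone level curve of the tuning observable `N`
  carrying the invariants (`N` preserved exactly, `Δβ ≤ K log (D/D₁)`, `|Δ X i| ≤ η i log (D/D₁)`); a limit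
  point of the curves' endpoints is a window state (closed invariants + the brancher's margin), the local
  level-set chart there (`levelSet_localChart`, helper file 1) matches the old curve by strict monotonicity of
  the `β`-slices, and `levelSet_localTransport` (helper file 1) pushes the invariants past the supremum unless
  it is `D₂` — no ODE existence theory is needed;
* §3 the stub, by unbundling the `CollapseOn` fields on `scalingWindow N (X i₀) …`.

Refs: line card `Lines/jacobian-collapse-gronwall.md` (stub B, "TRUE as stated"); Lüscher–Weisz–Wolff step
scaling / Gronwall along level sets.
-/

set_option autoImplicit false

open Set Filter Topology

namespace Summit.QuantumFields.YangMills.Cruxes.ContinuumLimitOnTrajectory.JacobianCollapseGronwall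

/-! ### §1 Part (b) in one variable -/

/-- **Ratio mean-value bound on an order-connected set** (part (b) of the level-set transport, in
one-variable form): if `g' ≠ 0` and `|f'| ≤ L |g'|` on the order-connected set `F`, then
`|f β - f β'| ≤ L |g β - g β'|` for `β, β' ∈ F` (Cauchy's mean value theorem: `Δf · g'(ξ) = Δg · f'(ξ)`). -/
theorem abs_sub_le_mul_abs_sub_of_deriv :
    ∀ (f g : ℝ → ℝ) (F : Set ℝ) (L : ℝ), F.OrdConnected →
      (∀ b ∈ F, DifferentiableAt ℝ f b) → (∀ b ∈ F, DifferentiableAt ℝ g b) →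
      (∀ b ∈ F, deriv g b ≠ 0) → (∀ b ∈ F, |deriv f b| ≤ L * |deriv g b|) →
      ∀ β ∈ F, ∀ β' ∈ F, |f β - f β'| ≤ L * |g β - g β'| := by
  intro f g F L hF hf hg hg0 hL
  have key : ∀ β ∈ F, ∀ β' ∈ F, β < β' → |f β' - f β| ≤ L * |g β' - g β| := by
    intro β hβ β' hβ' hlt
    have hsub : Icc β β' ⊆ F := hF.out hβ hβ'
    obtain ⟨c, hc, h⟩ := exists_ratio_deriv_eq_ratio_slope f hlt
      (fun x hx => (hf x (hsub hx)).continuousAt.continuousWithinAt)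
      (fun x hx => (hf x (hsub (Ioo_subset_Icc_self hx))).differentiableWithinAt)
      g (fun x hx => (hg x (hsub hx)).continuousAt.continuousWithinAt)
      (fun x hx => (hg x (hsub (Ioo_subset_Icc_self hx))).differentiableWithinAt)
    have hc' : c ∈ F := hsub (Ioo_subset_Icc_self hc)
    have hgc : deriv g c ≠ 0 := hg0 c hc'
    have hfb : f β' - f β = (g β' - g β) * deriv f c / deriv g c := by
      field_simp
      linarith
    rw [hfb, abs_div, abs_mul]
    calc |g β' - g β| * |deriv f c| / |deriv g c|
        ≤ |g β' - g β| * (L * |deriv g c|) / |deriv g c| := by gcongr; exact hL c hc'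
      _ = L * |g β' - g β| := by field_simp
  intro β hβ β' hβ'
  rcases lt_trichotomy β β' with hlt | rfl | hgt
  · rw [abs_sub_comm (f β), abs_sub_comm (g β)]
    exact key β hβ β' hβ' hlt
  · simp
  · exact key β' hβ' β hβ hgt

/-! ### §2 Part (a): continuation across the decade -/

/-- **Level-set continuation across the decade** (part (a) of the level-set transport, with the window
and the collapse hypotheses unbundled).  A window state `(D₁, β₀)` whose brancher `X i₀` is
`η i₀ log (D₂/D₁)`-inside `(ρ₁, ρ₂)` is joined, through window states on the level set `{N = N (D₁, β₀)}`
with non-decreasing coupling, to a state `(D₂, β₁)`, every `X i` moving by at most `η i log (D₂/D₁)`.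
Proof: continuation by supremum over the scales `D` reachable by a continuous monotone level curve
carrying the invariants; a limit point of the endpoints is a window state (closed invariants + margin), the
local chart there (`levelSet_localChart`) matches the old curve (strict monotonicity of the `β`-slices) and
`levelSet_localTransport` pushes the invariants beyond the supremum unless it is `D₂`. -/
theorem levelSet_continuation :
    ∀ (ι : Type) (i₀ : ι) (X : ι → ℝ → ℝ → ℝ) (N : ℝ → ℝ → ℝ) (B θ₁ θ₂ ρ₁ ρ₂ D₁ D₂ K : ℝ) (η : ι → ℝ)
      (β₀ : ℝ),
      0 < D₁ → D₁ ≤ D₂ → (∀ i, 0 ≤ η i) →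
      ContDiffOn ℝ 2 (Function.uncurry N) (Set.Ioi (0 : ℝ) ×ˢ (Set.univ : Set ℝ)) →
      (∀ i, ContDiffOn ℝ 2 (Function.uncurry (X i)) (Set.Ioi (0 : ℝ) ×ˢ (Set.univ : Set ℝ))) →
      (∀ (i : ι) (D b : ℝ), D ∈ Set.Icc D₁ D₂ → B ≤ b → N D b ∈ Set.Ioo θ₁ θ₂ →
          X i₀ D b ∈ Set.Ioo ρ₁ ρ₂ →
          deriv (N D) b ≠ 0 ∧ D * deriv (fun D' => N D' b) D * deriv (N D) b ≤ 0 ∧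
            |D * deriv (fun D' => N D' b) D| ≤ K * |deriv (N D) b| ∧
            |D * deriv (fun D' => X i D' b) D * deriv (N D) b -
                D * deriv (fun D' => N D' b) D * deriv (X i D) b| ≤ η i * |deriv (N D) b|) →
      B ≤ β₀ → N D₁ β₀ ∈ Set.Ioo θ₁ θ₂ →
      X i₀ D₁ β₀ ∈ Set.Ioo (ρ₁ + η i₀ * Real.log (D₂ / D₁)) (ρ₂ - η i₀ * Real.log (D₂ / D₁)) →
      ∃ β₁ : ℝ, β₀ ≤ β₁ ∧ N D₂ β₁ = N D₁ β₀ ∧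
        ∀ i, |X i D₂ β₁ - X i D₁ β₀| ≤ η i * Real.log (D₂ / D₁) := by
  intro ι i₀ X N B θ₁ θ₂ ρ₁ ρ₂ D₁ D₂ K η β₀ hD₁ hD₁₂ hη hN hX hW hB hN₀ hmar
  set N₀ : ℝ := N D₁ β₀ with hN₀def
  set ℓ : ℝ := Real.log (D₂ / D₁) with hℓdef
  have hlogmono : ∀ {D : ℝ}, D ∈ Icc D₁ D₂ → Real.log (D / D₁) ≤ ℓ := fun hD =>
    Real.log_le_log (div_pos (hD₁.trans_le hD.1) hD₁) (div_le_div_of_nonneg_right hD.2 hD₁.le)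
  have hℓ0 : 0 ≤ ℓ := Real.log_nonneg ((one_le_div hD₁).2 hD₁₂)
  have hX₀ : X i₀ D₁ β₀ ∈ Ioo ρ₁ ρ₂ :=
    ⟨by nlinarith [hmar.1, hη i₀], by nlinarith [hmar.2, hη i₀]⟩
  have hK : 0 ≤ K := by
    obtain ⟨hne, -, hsl, -⟩ := hW i₀ D₁ β₀ (left_mem_Icc.2 hD₁₂) hB hN₀ hX₀
    exact nonneg_of_mul_nonneg_left ((abs_nonneg _).trans hsl) (abs_pos.2 hne)
  -- the set of scales reachable by a continuous monotone level curve carrying the invariants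
  set T : Set ℝ := {D | D ∈ Icc D₁ D₂ ∧ ∃ g : ℝ → ℝ, g D₁ = β₀ ∧ ContinuousOn g (Icc D₁ D) ∧
      MonotoneOn g (Icc D₁ D) ∧ ∀ D' ∈ Icc D₁ D, N D' (g D') = N₀ ∧
        g D' - β₀ ≤ K * Real.log (D' / D₁) ∧
          ∀ i, |X i D' (g D') - X i D₁ β₀| ≤ η i * Real.log (D' / D₁)} with hTdef
  have hT₁ : D₁ ∈ T := by
    refine ⟨left_mem_Icc.2 hD₁₂, fun _ => β₀, rfl, continuousOn_const, fun _ _ _ _ _ => le_rfl, ?_⟩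
    intro D' hD'
    have hD'eq : D' = D₁ := le_antisymm hD'.2 hD'.1
    rw [hD'eq]
    exact ⟨rfl, by simp [hD₁.ne'], fun i => by simp [hD₁.ne']⟩
  have hTbdd : BddAbove T := ⟨D₂, fun D hD => hD.1.2⟩
  have hTne : T.Nonempty := ⟨D₁, hT₁⟩
  set S : ℝ := sSup T with hSdef
  have hS₁ : D₁ ≤ S := le_csSup hTbdd hT₁
  have hS₂ : S ≤ D₂ := csSup_le hTne fun D hD => hD.1.2
  have hS0 : 0 < S := hD₁.trans_le hS₁
  -- reachable scales tending to `S`, and a limit point of the endpoints of their curves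
  obtain ⟨u, -, hu, huT⟩ := exists_seq_tendsto_sSup hTne hTbdd
  choose g hg₁ hgc hgm hgP using fun n => (huT n).2
  have hu_mem : ∀ n, u n ∈ Icc D₁ D₂ := fun n => (huT n).1
  have hb_mem : ∀ n, g n (u n) ∈ Icc β₀ (β₀ + K * ℓ) := by
    intro n
    have h1 : D₁ ∈ Icc D₁ (u n) := left_mem_Icc.2 (hu_mem n).1
    have h2 : u n ∈ Icc D₁ (u n) := right_mem_Icc.2 (hu_mem n).1
    refine ⟨?_, ?_⟩
    · have := hgm n h1 h2 (hu_mem n).1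
      rwa [hg₁ n] at this
    · have := (hgP n (u n) h2).2.1
      nlinarith [hlogmono (hu_mem n), hK]
  obtain ⟨bs, -, φ, hφ, hbφ⟩ :=
    tendsto_subseq_of_bounded (Metric.isBounded_Icc β₀ (β₀ + K * ℓ)) hb_mem
  have huφ : Tendsto (u ∘ φ) atTop (𝓝 S) := hu.comp hφ.tendsto_atTop
  have hpair : Tendsto (fun n => (u (φ n), g (φ n) (u (φ n)))) atTop (𝓝 (S, bs)) :=
    huφ.prodMk_nhds hbφ
  -- the closed invariants pass to the limit point `(S, bs)`
  have hmemS : Set.Ioi (0 : ℝ) ×ˢ (Set.univ : Set ℝ) ∈ 𝓝 (S, bs) :=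
    (isOpen_Ioi.prod isOpen_univ).mem_nhds ⟨hS0, mem_univ _⟩
  have hPn : ∀ n, N (u (φ n)) (g (φ n) (u (φ n))) = N₀ ∧
      g (φ n) (u (φ n)) - β₀ ≤ K * Real.log (u (φ n) / D₁) ∧
        ∀ i, |X i (u (φ n)) (g (φ n) (u (φ n))) - X i D₁ β₀| ≤ η i * Real.log (u (φ n) / D₁) :=
    fun n => hgP (φ n) _ (right_mem_Icc.2 (hu_mem (φ n)).1)
  have hlevS : N S bs = N₀ := by
    have h1 : Tendsto (fun n => N (u (φ n)) (g (φ n) (u (φ n)))) atTop (𝓝 (N S bs)) :=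
      (hN.contDiffAt hmemS).continuousAt.tendsto.comp hpair
    have h2 : (fun n => N (u (φ n)) (g (φ n) (u (φ n)))) = fun _ => N₀ := funext fun n => (hPn n).1
    rw [h2] at h1
    exact tendsto_nhds_unique h1 tendsto_const_nhds
  have hlogc : Tendsto (fun n => Real.log (u (φ n) / D₁)) atTop (𝓝 (Real.log (S / D₁))) :=
    (Real.continuousAt_log (div_pos hS0 hD₁).ne').tendsto.comp (huφ.div_const D₁)
  have hβS : bs - β₀ ≤ K * Real.log (S / D₁) :=
    le_of_tendsto_of_tendsto' (hbφ.sub_const β₀) (hlogc.const_mul K) fun n => (hPn n).2.1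
  have hXS : ∀ i, |X i S bs - X i D₁ β₀| ≤ η i * Real.log (S / D₁) := fun i =>
    le_of_tendsto_of_tendsto'
      ((((hX i).contDiffAt hmemS).continuousAt.tendsto.comp hpair).sub_const (X i D₁ β₀)).abs
      (hlogc.const_mul (η i)) fun n => (hPn n).2.2 i
  have hβ₀S : β₀ ≤ bs := ge_of_tendsto' hbφ fun n => (hb_mem (φ n)).1
  -- hence the limit point is a window state
  have hBS : B ≤ bs := hB.trans hβ₀S
  have hNS : N S bs ∈ Ioo θ₁ θ₂ := hlevS ▸ hN₀
  have hXSin : X i₀ S bs ∈ Ioo ρ₁ ρ₂ := by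
    have h1 := hXS i₀
    have h2 : η i₀ * Real.log (S / D₁) ≤ η i₀ * ℓ :=
      mul_le_mul_of_nonneg_left (hlogmono ⟨hS₁, hS₂⟩) (hη i₀)
    rw [abs_le] at h1
    exact ⟨by linarith [hmar.1], by linarith [hmar.2]⟩
  have hN₂S : deriv (N S) bs ≠ 0 := (hW i₀ S bs ⟨hS₁, hS₂⟩ hBS hNS hXSin).1
  -- the open part of the window, and the level-set chart at the limit point
  set U : Set (ℝ × ℝ) := {p | 0 < p.1 ∧ N p.1 p.2 ∈ Ioo θ₁ θ₂ ∧ X i₀ p.1 p.2 ∈ Ioo ρ₁ ρ₂} with hUdef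
  have hUopen : IsOpen U := by
    have h1 : IsOpen ((Ioi (0 : ℝ) ×ˢ (univ : Set ℝ)) ∩ Function.uncurry N ⁻¹' Ioo θ₁ θ₂) :=
      hN.continuousOn.isOpen_inter_preimage (isOpen_Ioi.prod isOpen_univ) isOpen_Ioo
    have h2 : IsOpen (((Ioi (0 : ℝ) ×ˢ (univ : Set ℝ)) ∩ Function.uncurry N ⁻¹' Ioo θ₁ θ₂) ∩
        Function.uncurry (X i₀) ⁻¹' Ioo ρ₁ ρ₂) :=
      ((hX i₀).continuousOn.mono inter_subset_left).isOpen_inter_preimage h1 isOpen_Ioo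
    convert h2 using 1
    ext ⟨D, b⟩
    simp [hUdef, Function.uncurry, and_assoc]
  have hSU : (S, bs) ∈ U := ⟨hS0, hNS, hXSin⟩
  obtain ⟨ψ, δ, ε, hδ, hε, -, -, hboxU, hsign, hmono, hψ⟩ :=
    levelSet_localChart N U S bs hN hUopen hSU hS0 hN₂S
  have hbox : ∀ D ∈ Ioo (S - δ) (S + δ), ∀ b ∈ Ioo (bs - ε) (bs + ε),
      0 < D ∧ N D b ∈ Ioo θ₁ θ₂ ∧ X i₀ D b ∈ Ioo ρ₁ ρ₂ ∧ 0 < deriv (N S) bs * deriv (N D) b := by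
    intro D hD b hb
    have hU' : (D, b) ∈ U := hboxU (Set.mk_mem_prod hD hb)
    exact ⟨hU'.1, hU'.2.1, hU'.2.2, hsign D hD b hb⟩
  -- a reachable scale `Da` whose curve ends inside the chart's box
  have hev : ∀ᶠ n in atTop, (u ∘ φ) n ∈ Ioo (S - δ) (S + δ) ∧
      ((fun n => g n (u n)) ∘ φ) n ∈ Ioo (bs - ε) (bs + ε) :=
    (huφ.eventually (Ioo_mem_nhds (by linarith) (by linarith))).and
      (hbφ.eventually (Ioo_mem_nhds (by linarith) (by linarith)))
  obtain ⟨n, hnD, hnb⟩ := hev.exists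
  set Da : ℝ := u (φ n) with hDadef
  have hnD' : Da ∈ Ioo (S - δ) (S + δ) := hnD
  have hnb' : g (φ n) Da ∈ Ioo (bs - ε) (bs + ε) := hnb
  have hDa12 : Da ∈ Icc D₁ D₂ := hu_mem (φ n)
  have hDaS : Da ≤ S := le_csSup hTbdd (huT (φ n))
  -- the old curve ends ON the chart (strict monotonicity of the `β`-slices)
  have hEq : g (φ n) Da = ψ Da := by
    have h1 : N Da (g (φ n) Da) = N₀ := (hPn n).1
    have h2 : N Da (ψ Da) = N₀ := (hψ Da hnD').2.1.trans hlevS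
    exact (hmono Da hnD').injOn hnb' (hψ Da hnD').1 (by simp only [h1, h2])
  -- the extension's endpoint
  set Db : ℝ := min (S + δ / 2) D₂ with hDbdef
  have hDbI : Db ∈ Ioo (S - δ) (S + δ) :=
    ⟨lt_min (by linarith) (by linarith), (min_le_left _ _).trans_lt (by linarith)⟩
  have hDaDb : Da ≤ Db := le_min (by linarith) hDa12.2
  have hDb2 : Db ≤ D₂ := min_le_right _ _
  have hBψ : B ≤ ψ Da := by
    rw [← hEq]
    have := hgm (φ n) (left_mem_Icc.2 hDa12.1) (right_mem_Icc.2 hDa12.1) hDa12.1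
    rw [hg₁] at this
    exact hB.trans this
  obtain ⟨hmonoψ, hcontψ, hloc⟩ := levelSet_localTransport ι i₀ X N B θ₁ θ₂ ρ₁ ρ₂ D₁ D₂ K η ψ S bs
    δ ε Da Db hN hX hW hbox hmono hψ hnD' hDbI hDa12.1 hDaDb hDb2 hBψ
  -- glue the old curve (up to `Da`) with the chart (from `Da` to `Db`)
  set g' : ℝ → ℝ := fun D => if D ≤ Da then g (φ n) D else ψ D with hg'def
  have hg'l : ∀ {D : ℝ}, D ≤ Da → g' D = g (φ n) D := fun h => if_pos h
  have hg'r : ∀ {D : ℝ}, Da ≤ D → g' D = ψ D := by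
    intro D h
    rcases h.eq_or_lt with h' | h'
    · rw [← h', hg'l le_rfl, hEq]
    · exact if_neg (not_le.2 h')
  have hDbT : Db ∈ T := by
    refine ⟨⟨hDa12.1.trans hDaDb, hDb2⟩, g', ?_, ?_, ?_, ?_⟩
    · rw [hg'l hDa12.1, hg₁]
    · refine ContinuousOn.if ?_ ?_ ?_
      · rintro a ⟨-, ha⟩
        rw [show {a : ℝ | a ≤ Da} = Iic Da from rfl, frontier_Iic] at ha
        rw [mem_singleton_iff.1 ha]
        exact hEq
      · rw [show {a : ℝ | a ≤ Da} = Iic Da from rfl, closure_Iic]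
        exact (hgc (φ n)).mono fun a ha => ⟨ha.1.1, ha.2⟩
      · have hIoi : {a : ℝ | ¬a ≤ Da} = Ioi Da := by
          ext a
          simp
        rw [hIoi, closure_Ioi]
        exact hcontψ.mono fun a ha => ⟨ha.2, ha.1.2⟩
    · intro x hx y hy hxy
      rcases le_total y Da with hyD | hyD
      · rw [hg'l (hxy.trans hyD), hg'l hyD]
        exact hgm (φ n) ⟨hx.1, hxy.trans hyD⟩ ⟨hy.1, hyD⟩ hxy
      rcases le_total x Da with hxD | hxD
      · rw [hg'l hxD, hg'r hyD]
        calc g (φ n) x ≤ g (φ n) Da := hgm (φ n) ⟨hx.1, hxD⟩ (right_mem_Icc.2 hDa12.1) hxD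
          _ = ψ Da := hEq
          _ ≤ ψ y := hmonoψ (left_mem_Icc.2 hDaDb) ⟨hyD, hy.2⟩ hyD
      · rw [hg'r hxD, hg'r hyD]
        exact hmonoψ ⟨hxD, hxy.trans hy.2⟩ ⟨hyD, hy.2⟩ hxy
    · intro D' hD'
      rcases le_total D' Da with h | h
      · rw [hg'l h]
        exact hgP (φ n) D' ⟨hD'.1, h⟩
      · rw [hg'r h]
        obtain ⟨-, hKb, hXb⟩ := hloc D' ⟨h, hD'.2⟩
        obtain ⟨-, hKa, hXa⟩ := hPn n
        have hDa0 : 0 < Da := hD₁.trans_le hDa12.1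
        have hsplit : Real.log (D' / D₁) = Real.log (D' / Da) + Real.log (Da / D₁) := by
          rw [Real.log_div (hDa0.trans_le h).ne' hD₁.ne', Real.log_div (hDa0.trans_le h).ne' hDa0.ne',
            Real.log_div hDa0.ne' hD₁.ne']
          ring
        refine ⟨(hψ D' ⟨hnD'.1.trans_le h, hD'.2.trans_lt hDbI.2⟩).2.1.trans hlevS, ?_, fun i => ?_⟩
        · rw [hsplit, mul_add]
          rw [← hEq] at hKb
          change g (φ n) Da - β₀ ≤ K * Real.log (Da / D₁) at hKa
          linarith
        · calc |X i D' (ψ D') - X i D₁ β₀|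
              ≤ |X i D' (ψ D') - X i Da (ψ Da)| + |X i Da (ψ Da) - X i D₁ β₀| := abs_sub_le _ _ _
            _ ≤ η i * Real.log (D' / Da) + η i * Real.log (Da / D₁) := by
                refine add_le_add (hXb i) ?_
                rw [← hEq]
                exact hXa i
            _ = η i * Real.log (D' / D₁) := by rw [hsplit, mul_add]
  have hDbS : Db ≤ S := le_csSup hTbdd hDbT
  -- hence `Db = D₂ (= S)`, and the glued curve's endpoint is the transported state
  have hDbD₂ : Db = D₂ := by
    rcases min_cases (S + δ / 2) D₂ with ⟨h, -⟩ | ⟨h, -⟩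
    · exfalso
      have : Db = S + δ / 2 := h
      linarith
    · exact h
  obtain ⟨-, g₂, hg₂1, -, hg₂m, hg₂P⟩ := hDbT
  have hD₂mem : D₂ ∈ Icc D₁ Db := ⟨hD₁₂, hDbD₂.ge⟩
  refine ⟨g₂ D₂, ?_, (hg₂P D₂ hD₂mem).1, fun i => (hg₂P D₂ hD₂mem).2.2 i⟩
  have := hg₂m ⟨le_rfl, hD₁₂.trans hDbD₂.ge⟩ hD₂mem hD₁₂
  rwa [hg₂1] at this

/-! ### §3 The stub -/

/-- **Stub B of line `jacobian-collapse-gronwall`: level-set transport** (`LevelSetTransport`, pure real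
analysis).  (a) is `levelSet_continuation` with the `CollapseOn` fields unbundled on the scaling window;
(b) is the ratio mean-value bound `abs_sub_le_mul_abs_sub_of_deriv` on the order-connected `β`-fibre, the
slices `b ↦ N D b`, `b ↦ X i D b` being differentiable because the data are `C²` on `{D > 0}`. -/
theorem stub_levelSetTransport : LevelSetTransport := by
  intro ι i₀ X N B θ₁ θ₂ ρ₁ ρ₂ D₁ D₂ K η Lip hD₁ hD₁₂ hη _hLip hC
  have hW : ∀ (i : ι) (D b : ℝ), D ∈ Set.Icc D₁ D₂ → B ≤ b → N D b ∈ Set.Ioo θ₁ θ₂ →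
      X i₀ D b ∈ Set.Ioo ρ₁ ρ₂ →
      deriv (N D) b ≠ 0 ∧ D * deriv (fun D' => N D' b) D * deriv (N D) b ≤ 0 ∧
        |D * deriv (fun D' => N D' b) D| ≤ K * |deriv (N D) b| ∧
        |D * deriv (fun D' => X i D' b) D * deriv (N D) b -
            D * deriv (fun D' => N D' b) D * deriv (X i D) b| ≤ η i * |deriv (N D) b| := by
    intro i D b hD hb hNb hXb
    have hp : (D, b) ∈ scalingWindow N (X i₀) B θ₁ θ₂ ρ₁ ρ₂ := ⟨hb, hNb, hXb⟩
    exact ⟨(hC i).deriv_ne (D, b) hp hD, (hC i).ascend (D, b) hp hD, (hC i).slope_le (D, b) hp hD,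
      (hC i).jac_le (D, b) hp hD⟩
  refine ⟨fun β₀ hβ₀ hmar => ?_, fun D hD hF β β' hβ hβ' i => ?_⟩
  · exact levelSet_continuation ι i₀ X N B θ₁ θ₂ ρ₁ ρ₂ D₁ D₂ K η β₀ hD₁ hD₁₂ hη (hC i₀).smooth_N
      (fun i => (hC i).smooth_X) hW hβ₀.1 hβ₀.2.1 hmar
  · have hD0 : 0 < D := hD₁.trans_le hD.1
    exact abs_sub_le_mul_abs_sub_of_deriv (X i D) (N D)
      {b : ℝ | (D, b) ∈ scalingWindow N (X i₀) B θ₁ θ₂ ρ₁ ρ₂} (Lip i) hF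
      (fun b _ => (hasDerivAt_slice_snd
        (differentiableAt_of_contDiffOn_halfPlane (hC i).smooth_X b hD0)).differentiableAt)
      (fun b _ => (hasDerivAt_slice_snd
        (differentiableAt_of_contDiffOn_halfPlane (hC i).smooth_N b hD0)).differentiableAt)
      (fun b hb => (hC i).deriv_ne (D, b) hb hD) (fun b hb => (hC i).lip_le (D, b) hb hD) β hβ β' hβ'

end Summit.QuantumFields.YangMills.Cruxes.ContinuumLimitOnTrajectory.JacobianCollapseGronwall
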